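import Summits.ValiantsHypothesis.ValiantsHypothesis.Theorems.MonotoneRestorationOrbitCompressionQPExtractionTerm
import Summits.ValiantsHypothesis.ValiantsHypothesis.Theorems.MonotoneRestorationOrbitCompressionQPSupportForm
import HarnessLib

/-!
# Route MonotoneRestoration — aside `OrbitCompressionQP` (stmt-ValiantsHypothesis-18332): THE EXTRACTION
# THEOREM (S1b′) — polylog-SUPPORTED computations are narrow ONE-SORTED expressions

Item evidence `S1b-plan.md`, step (iv): induction over a value derivation all of whose values are fixed by
the pointwise stabilisers of `≤ s` indices (`3s ≤ k` labels, `s + 3 ≤ n`): every value is REPRESENTED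
(`OrbitSupport.exists_term`'s sense) by a one-sorted expression on `≤ s` labels — variables by `edge`
(both indices lie in the support: 3-cycles), weighted sums and products by the term lemma (Reynolds over
the stabiliser of the support, peeling of the foreign labels).  Consequently a diagonally INVARIANT value
is the closed polynomial of a one-sorted expression with `k = 3s` labels.

* `exists_labelling` — labels for a set of `≤ k` indices;
* `extraction_repr` — every value of a supported derivation is represented on `≤ s` labels;
* `exists_diClose_of_supportedDerivation` — **a diagonally invariant polynomial with a computation (any
  length) through values supported on `≤ s` indices is `e.close n` for a one-sorted expression `e` with
  `3s` labels**;
* `diNarrow_of_qpOrbitFamily` — **with `OrbitSupport.supportedDerivations_of_qpOrbitFamily`: square-symmetric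
  circuits of quasi-polynomial ORBIT size ⇒ (from some `n₀` on) closed one-sorted expressions with
  `n^{k_n} ≤ 2^{(log₂ n + c')^{c'}}` labels** — with `NarrowToOrbit.qpOrbit_of_diNarrowExpression` the
  converse: the ONE-SORTED form of Dawar–Pago–Seppelt's characterisation at the quasi-polynomial scale
  (their p. 17 Remark / p. 45 question for `Sym_n`), VH-free and `VP`-free.  What it does NOT give is a
  BIPARTITE narrow expression for a matrix-symmetric family (S1c, open).

Helper file (`--supports stmt-ValiantsHypothesis-18332`); def-free; nothing here is a named fact.
-/

noncomputable section

open scoped Classical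

-- `Summit.ValiantsHypothesis.ValiantsHypothesis.…` is the tree's single-conjunct layout (Sub = Summit).
set_option linter.dupNamespace false

namespace Summit.ValiantsHypothesis.ValiantsHypothesis.Theorems

namespace OrbitSupport

open Literature.Computability.AlgebraicComplexity MvPolynomial DiPatternExpr

variable {n k : ℕ}

/-- **Labels for a set of indices**: a set `X` of `≤ k` indices is carried injectively by some labels
`LX` at some assignment `ℓ₀` (`ℓ₀(LX) = X`). [folklore] -/
theorem exists_labelling (hn : 0 < n) (X : Finset (Fin n)) (hX : X.card ≤ k) :
    ∃ (LX : Finset (Fin k)) (ℓ₀ : Fin k → Fin n), LX.image ℓ₀ = X ∧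
      ∀ a ∈ LX, ∀ b ∈ LX, ℓ₀ a = ℓ₀ b → a = b := by
  let f : X → Fin k := fun x => Fin.castLE hX (X.equivFin x)
  have hf : Function.Injective f := fun x y h =>
    X.equivFin.injective (Fin.castLE_injective hX h)
  let ℓ₀ : Fin k → Fin n := fun b => if h : ∃ x : X, f x = b then ((Classical.choose h : X) : Fin n) else ⟨0, hn⟩
  have hℓ₀ : ∀ x : X, ℓ₀ (f x) = x := by
    intro x
    have h : ∃ y : X, f y = f x := ⟨x, rfl⟩
    simp only [ℓ₀, dif_pos h]
    exact congrArg Subtype.val (hf (Classical.choose_spec h))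
  refine ⟨(Finset.univ : Finset X).image f, ℓ₀, ?_, ?_⟩
  · ext y
    simp only [Finset.mem_image, Finset.mem_univ, true_and]
    constructor
    · rintro ⟨b, ⟨x, rfl⟩, rfl⟩; rw [hℓ₀]; exact x.2
    · intro hy; exact ⟨f ⟨y, hy⟩, ⟨⟨y, hy⟩, rfl⟩, hℓ₀ ⟨y, hy⟩⟩
  · intro a ha b hb hab
    obtain ⟨x, -, rfl⟩ := Finset.mem_image.1 ha
    obtain ⟨y, -, rfl⟩ := Finset.mem_image.1 hb
    rw [hℓ₀, hℓ₀] at hab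
    rw [Subtype.ext hab]

/-- The variable `x_ij` is fixed by the pointwise stabiliser of `X` only if `i, j ∈ X` (`|X| + 3 ≤ n`:
a 3-cycle outside `X` moves any index outside `X`). [folklore] -/
theorem mem_of_var_fixed {X : Finset (Fin n)} (hXn : X.card + 3 ≤ n) (x : Fin n × Fin n)
    (hX : ∀ ρ : Equiv.Perm (Fin n), (∀ y ∈ X, ρ y = y) →
      ren ρ (MvPolynomial.X x : MvPolynomial (Fin n × Fin n) ℂ) = MvPolynomial.X x) :
    x.1 ∈ X ∧ x.2 ∈ X := by
  have key : ∀ i : Fin n, (∀ ρ : Equiv.Perm (Fin n), (∀ y ∈ X, ρ y = y) → ρ i = i) → i ∈ X := by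
    intro i hi
    by_contra hiX
    have hcard : 2 ≤ (Finset.univ \ (insert i X)).card := by
      rw [Finset.card_univ_sdiff, Fintype.card_fin]
      have := Finset.card_insert_le i X
      omega
    obtain ⟨c, hc, c', hc', hcc'⟩ := Finset.one_lt_card.1 hcard
    simp only [Finset.mem_sdiff, Finset.mem_univ, Finset.mem_insert, not_or, true_and] at hc hc'
    have h := hi (Equiv.swap i c * Equiv.swap c c') fun y hy => by
      rw [Equiv.Perm.mul_apply, Equiv.swap_apply_of_ne_of_ne (ne_of_mem_of_not_mem hy hc.2)
        (ne_of_mem_of_not_mem hy hc'.2), Equiv.swap_apply_of_ne_of_ne (ne_of_mem_of_not_mem hy hiX)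
        (ne_of_mem_of_not_mem hy hc.2)]
    rw [Equiv.Perm.mul_apply, Equiv.swap_apply_of_ne_of_ne (Ne.symm hc.1) (Ne.symm hc'.1),
      Equiv.swap_apply_left] at h
    exact hc.1 h
  have hfix : ∀ ρ : Equiv.Perm (Fin n), (∀ y ∈ X, ρ y = y) → (ρ x.1, ρ x.2) = x := by
    intro ρ hρ
    have h := hX ρ hρ
    rw [ren_X] at h
    exact MvPolynomial.X_injective h
  exact ⟨key x.1 fun ρ hρ => congrArg Prod.fst (hfix ρ hρ), key x.2 fun ρ hρ => congrArg Prod.snd (hfix ρ hρ)⟩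

/-- Arithmetic of the averaging: `m • (C c * (N • v)) = C (m c N) * v`. [folklore] -/
theorem nsmul_C_mul_nsmul (m N : ℕ) (c : ℂ) (v : MvPolynomial (Fin n × Fin n) ℂ) :
    m • (C c * (N • v)) = C ((m : ℂ) * c * N) * v := by
  rw [nsmul_eq_mul, nsmul_eq_mul, map_mul, map_mul, map_natCast, map_natCast]; ring

/-- Dividing by a positive natural number: `g • q = p` gives `q = C g⁻¹ * p`. [folklore] -/
theorem eq_C_inv_mul_of_nsmul_eq {g : ℕ} (hg : 0 < g) {q p : MvPolynomial (Fin n × Fin n) ℂ}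
    (h : g • q = p) : q = C ((g : ℂ)⁻¹) * p := by
  rw [← h, nsmul_eq_mul, ← mul_assoc, ← map_natCast C, ← map_mul,
    inv_mul_cancel₀ (by exact_mod_cast hg.ne'), map_one, one_mul]

/-- **EVERY VALUE OF A SUPPORTED DERIVATION IS REPRESENTED ON `≤ s` LABELS.**  Let every value of the
value derivation `𝒟` be fixed by the pointwise stabiliser of some `≤ s` indices, `3s ≤ k`, `s + 3 ≤ n`.
Then every `q ∈ 𝒟.S` is `value E ℓ₀` for a one-sorted expression `E` with `k` labels and an assignment `ℓ₀`
injective on a set `LX` of `≤ s` labels, the value of `E` at assignments injective on `LX` depending only on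
their restriction to `LX`. [cite: DawarPagoSeppelt2025, §4 (Lemma 4.3 / Theorem 1.1, one-sorted, value form)] -/
theorem extraction_repr {s : ℕ} (hk : 3 * s ≤ k) (hn : s + 3 ≤ n)
    (𝒟 : ValueDerivation ℂ (Fin n × Fin n))
    (hS : ∀ q ∈ 𝒟.S, ∃ X : Finset (Fin n), X.card ≤ s ∧
      ∀ ρ : Equiv.Perm (Fin n), (∀ x ∈ X, ρ x = x) → ren ρ q = q) :
    ∀ q ∈ 𝒟.S, ∃ (E : DiPatternExpr ℂ k) (LX : Finset (Fin k)) (ℓ₀ : Fin k → Fin n),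
      LX.card ≤ s ∧ (∀ a ∈ LX, ∀ b ∈ LX, ℓ₀ a = ℓ₀ b → a = b) ∧
      (∀ ℓ₁ ℓ₂ : Fin k → Fin n, (∀ a ∈ LX, ∀ b ∈ LX, ℓ₁ a = ℓ₁ b → a = b) →
        (∀ a ∈ LX, ∀ b ∈ LX, ℓ₂ a = ℓ₂ b → a = b) → (∀ a ∈ LX, ℓ₁ a = ℓ₂ a) →
        value n E ℓ₁ = value n E ℓ₂) ∧
      value n E ℓ₀ = q := by
  suffices H : ∀ (r : ℕ) (q : MvPolynomial (Fin n × Fin n) ℂ), q ∈ 𝒟.S → 𝒟.rank q = r →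
      ∃ (E : DiPatternExpr ℂ k) (LX : Finset (Fin k)) (ℓ₀ : Fin k → Fin n),
        LX.card ≤ s ∧ (∀ a ∈ LX, ∀ b ∈ LX, ℓ₀ a = ℓ₀ b → a = b) ∧
        (∀ ℓ₁ ℓ₂ : Fin k → Fin n, (∀ a ∈ LX, ∀ b ∈ LX, ℓ₁ a = ℓ₁ b → a = b) →
          (∀ a ∈ LX, ∀ b ∈ LX, ℓ₂ a = ℓ₂ b → a = b) → (∀ a ∈ LX, ℓ₁ a = ℓ₂ a) →
          value n E ℓ₁ = value n E ℓ₂) ∧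
        value n E ℓ₀ = q from fun q hq => H _ q hq rfl
  intro r
  induction r using Nat.strong_induction_on with
  | _ r ih =>
  intro q hq hr
  obtain ⟨X, hXs, hX⟩ := hS q hq
  obtain ⟨LX, ℓ₀, hLX, hinjLX⟩ := exists_labelling (k := k) (by omega) X (hXs.trans (by omega))
  have hLXcard : LX.card ≤ s := by
    rw [← Finset.card_image_of_injOn (f := ℓ₀) (s := LX) fun a ha b hb h => hinjLX a ha b hb h, hLX]
    exact hXs
  have hℓ₀X : ∀ a ∈ LX, ℓ₀ a ∈ X := fun a ha => hLX ▸ Finset.mem_image_of_mem ℓ₀ ha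
  -- the stabiliser and the averaging identity for `q`
  set G := Finset.univ.filter (fun ρ : Equiv.Perm (Fin n) => ∀ x ∈ X, ρ x = x) with hG
  have hGpos : 0 < G.card := Finset.card_pos.2 ⟨1, by simp [hG]⟩
  have hGsum : ∑ ρ ∈ G, ren ρ q = G.card • q := by
    rw [Finset.sum_congr rfl fun ρ hρ => hX ρ (Finset.mem_filter.1 hρ).2, Finset.sum_const]
  -- lower-rank values, averaged over the stabiliser, are represented on `LX` (term lemma)
  have hterm : ∀ u : MvPolynomial (Fin n × Fin n) ℂ, u ∈ 𝒟.S → 𝒟.rank u < r →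
      ∃ (T : DiPatternExpr ℂ k) (N : ℕ), 0 < N ∧
        (∀ ℓ₁ ℓ₂ : Fin k → Fin n, (∀ a ∈ LX, ∀ b ∈ LX, ℓ₁ a = ℓ₁ b → a = b) →
          (∀ a ∈ LX, ∀ b ∈ LX, ℓ₂ a = ℓ₂ b → a = b) → (∀ a ∈ LX, ℓ₁ a = ℓ₂ a) →
          value n T ℓ₁ = value n T ℓ₂) ∧
        ∑ ρ ∈ G, ren ρ u = N • value n T ℓ₀ := by
    intro u hu hlt
    obtain ⟨Eu, LXu, ℓu, hcu, hinju, hdepu, hvalu⟩ := ih _ hlt u hu rfl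
    obtain ⟨T, N, hN, hTdep, hTsum⟩ :=
      exists_term hk X LX ℓ₀ hLX hinjLX hXs Eu ℓu LXu (hcu.trans (by omega)) hinju hdepu
    exact ⟨T, N, hN, hTdep, by rw [← hvalu]; exact hTsum⟩
  haveI : Inhabited (DiPatternExpr ℂ k) := ⟨const 0⟩
  choose! T N hN hTdep hTsum using hterm
  obtain ⟨d, hd⟩ := 𝒟.step q hq
  rcases d with x | c | D | ⟨u, v⟩
  · -- a variable: both indices lie in the support
    have hqx : q = MvPolynomial.X x := hd.value_eq.symm
    obtain ⟨h1, h2⟩ := mem_of_var_fixed (X := X) (by omega) x fun ρ hρ => by rw [← hqx]; exact hX ρ hρ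
    obtain ⟨a₁, ha₁, hℓa₁⟩ := Finset.mem_image.1 (hLX.symm ▸ h1)
    obtain ⟨a₂, ha₂, hℓa₂⟩ := Finset.mem_image.1 (hLX.symm ▸ h2)
    refine ⟨edge a₁ a₂, LX, ℓ₀, hLXcard, hinjLX, fun ℓ₁ ℓ₂ _ _ h => ?_, ?_⟩
    · simp only [value_edge]; rw [h a₁ ha₁, h a₂ ha₂]
    · simp only [value_edge]; rw [hℓa₁, hℓa₂, hqx]
  · -- a constant
    exact ⟨const c, LX, ℓ₀, hLXcard, hinjLX, fun _ _ _ _ _ => rfl, hd.value_eq⟩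
  · -- a weighted sum: average, term lemma for every summand
    have hargs : ∀ cu ∈ D, cu.2 ∈ 𝒟.S ∧ 𝒟.rank cu.2 < r := fun cu hcu => by
      have := hd.args_lt cu.2 (by simp only [StepData.args, Multiset.mem_map]; exact ⟨cu, hcu, rfl⟩)
      exact ⟨this.1, hr ▸ this.2⟩
    have hargs' : ∀ cu ∈ D.toFinset.toList, cu.2 ∈ 𝒟.S ∧ 𝒟.rank cu.2 < r := fun cu hcu =>
      hargs cu (Multiset.mem_toFinset.1 (Finset.mem_toList.1 hcu))
    refine ⟨mul (const ((G.card : ℂ)⁻¹)) ((D.toFinset.toList.map fun cu =>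
        mul (const ((D.count cu : ℂ) * cu.1 * (N cu.2 : ℂ))) (T cu.2)).foldr add (const 0)),
      LX, ℓ₀, hLXcard, hinjLX, fun ℓ₁ ℓ₂ h₁ h₂ h₁₂ => ?_, ?_⟩
    · simp only [value_mul, value_const, value_foldr_add, List.map_map, Function.comp_def]
      congr 1
      refine congrArg List.sum (List.map_congr_left fun cu hcu => ?_)
      rw [hTdep cu.2 (hargs' cu hcu).1 (hargs' cu hcu).2 ℓ₁ ℓ₂ h₁ h₂ h₁₂]
    · -- the averaging computation
      have hqD : q = ∑ cu ∈ D.toFinset, D.count cu • (C cu.1 * cu.2) := by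
        rw [← hd.value_eq]
        exact Finset.sum_multiset_map_count D _
      have hρq : ∀ ρ : Equiv.Perm (Fin n),
          ren ρ q = ∑ cu ∈ D.toFinset, D.count cu • (C cu.1 * ren ρ cu.2) := by
        intro ρ
        rw [hqD, map_sum]
        refine Finset.sum_congr rfl fun cu _ => ?_
        rw [map_nsmul, map_mul, ren_C]
      have htot : G.card • q = ∑ cu ∈ D.toFinset, D.count cu • (C cu.1 * (N cu.2 • value n (T cu.2) ℓ₀)) := by
        rw [← hGsum, Finset.sum_congr rfl fun ρ _ => hρq ρ, Finset.sum_comm]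
        refine Finset.sum_congr rfl fun cu hcu => ?_
        have hcu' := hargs cu (Multiset.mem_toFinset.1 hcu)
        rw [← Finset.smul_sum, ← Finset.mul_sum, hTsum cu.2 hcu'.1 hcu'.2]
      rw [eq_C_inv_mul_of_nsmul_eq hGpos htot]
      simp only [value_mul, value_const, value_foldr_add, List.map_map, Function.comp_def]
      congr 1
      rw [Finset.sum_map_toList]
      exact Finset.sum_congr rfl fun cu _ => (nsmul_C_mul_nsmul _ _ _ _).symm
  · -- a product: joint representation of `u · v` on `≤ 2s` labels, then the term lemma
    have hu := hd.args_lt u (by simp [StepData.args])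
    have hv := hd.args_lt v (by simp [StepData.args])
    obtain ⟨Eu, LXu, ℓu, hcu, hinju, hdepu, hvalu⟩ := ih _ (hr ▸ hu.2) u hu.1 rfl
    obtain ⟨Ev, LXv, ℓv, hcv, hinjv, hdepv, hvalv⟩ := ih _ (hr ▸ hv.2) v hv.1 rfl
    set Z : Finset (Fin n) := LXu.image ℓu ∪ LXv.image ℓv with hZ
    have hZcard : Z.card ≤ 2 * s :=
      (Finset.card_union_le _ _).trans (Nat.add_le_add (Finset.card_image_le.trans hcu)
        (Finset.card_image_le.trans hcv)) |>.trans (by omega)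
    obtain ⟨LZ, ℓZ, hLZ, hinjZ⟩ := exists_labelling (k := k) (by omega) Z (hZcard.trans (by omega))
    have hLZcard : LZ.card ≤ 2 * s := by
      rw [← Finset.card_image_of_injOn (f := ℓZ) (s := LZ) fun a ha b hb h => hinjZ a ha b hb h, hLZ]
      exact hZcard
    have hZlab : ∀ z ∈ Z, ∃ b ∈ LZ, ℓZ b = z := fun z hz => Finset.mem_image.1 (hLZ ▸ hz)
    -- relabel `Eu` and `Ev` onto `LZ`
    have hrel : ∀ (Ew : DiPatternExpr ℂ k) (LXw : Finset (Fin k)) (ℓw : Fin k → Fin n) (w : MvPolynomial _ ℂ),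
        (∀ a ∈ LXw, ∀ b ∈ LXw, ℓw a = ℓw b → a = b) →
        (∀ ℓ₁ ℓ₂ : Fin k → Fin n, (∀ a ∈ LXw, ∀ b ∈ LXw, ℓ₁ a = ℓ₁ b → a = b) →
          (∀ a ∈ LXw, ∀ b ∈ LXw, ℓ₂ a = ℓ₂ b → a = b) → (∀ a ∈ LXw, ℓ₁ a = ℓ₂ a) →
          value n Ew ℓ₁ = value n Ew ℓ₂) →
        value n Ew ℓw = w → LXw.image ℓw ⊆ Z →
        ∃ Ew' : DiPatternExpr ℂ k, value n Ew' ℓZ = w ∧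
          ∀ ℓ₁ ℓ₂ : Fin k → Fin n, (∀ a ∈ LZ, ∀ b ∈ LZ, ℓ₁ a = ℓ₁ b → a = b) →
            (∀ a ∈ LZ, ∀ b ∈ LZ, ℓ₂ a = ℓ₂ b → a = b) → (∀ a ∈ LZ, ℓ₁ a = ℓ₂ a) →
            value n Ew' ℓ₁ = value n Ew' ℓ₂ := by
      intro Ew LXw ℓw w hinjw hdepw hvalw hsub
      have hlab : ∀ a ∈ LXw, ∃ b ∈ LZ, ℓZ b = ℓw a := fun a ha =>
        hZlab _ (hsub (Finset.mem_image_of_mem ℓw ha))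
      let τ : Fin k → Fin k := fun a => if ha : a ∈ LXw then Classical.choose (hlab a ha) else a
      have hτ : ∀ a ∈ LXw, τ a ∈ LZ ∧ ℓZ (τ a) = ℓw a := fun a ha => by
        simp only [τ, dif_pos ha]; exact Classical.choose_spec (hlab a ha)
      have hτinj : ∀ a ∈ LXw, ∀ b ∈ LXw, τ a = τ b → a = b := fun a ha b hb hab =>
        hinjw a ha b hb (by rw [← (hτ a ha).2, ← (hτ b hb).2, hab])
      obtain ⟨Ew', hval', hdep'⟩ := exists_relabel Ew LXw hdepw τ hτinj
      have himg : ∀ c ∈ LXw.image τ, c ∈ LZ := fun c hc => by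
        obtain ⟨a, ha, rfl⟩ := Finset.mem_image.1 hc; exact (hτ a ha).1
      refine ⟨Ew', (hval' ℓw ℓZ hinjw fun a ha => (hτ a ha).2).trans hvalw, fun ℓ₁ ℓ₂ h₁ h₂ h₁₂ =>
        hdep' ℓ₁ ℓ₂ (fun a ha b hb => h₁ a (himg a ha) b (himg b hb))
          (fun a ha b hb => h₂ a (himg a ha) b (himg b hb)) fun a ha => h₁₂ a (himg a ha)⟩
    obtain ⟨Eu', hvalu', hdepu'⟩ := hrel Eu LXu ℓu u hinju hdepu hvalu Finset.subset_union_left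
    obtain ⟨Ev', hvalv', hdepv'⟩ := hrel Ev LXv ℓv v hinjv hdepv hvalv Finset.subset_union_right
    obtain ⟨T₀, N₀, hN₀, hT₀dep, hT₀sum⟩ := exists_term hk X LX ℓ₀ hLX hinjLX hXs (mul Eu' Ev') ℓZ LZ
      hLZcard hinjZ (fun ℓ₁ ℓ₂ h₁ h₂ h₁₂ => by
        rw [value_mul, value_mul, hdepu' ℓ₁ ℓ₂ h₁ h₂ h₁₂, hdepv' ℓ₁ ℓ₂ h₁ h₂ h₁₂])
    have hqW : q = value n (mul Eu' Ev') ℓZ := by rw [value_mul, hvalu', hvalv']; exact hd.value_eq.symm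
    have htot : G.card • q = N₀ • value n T₀ ℓ₀ := by rw [← hGsum, hqW, hT₀sum]
    refine ⟨mul (const ((G.card : ℂ)⁻¹ * N₀)) T₀, LX, ℓ₀, hLXcard, hinjLX, fun ℓ₁ ℓ₂ h₁ h₂ h₁₂ => ?_, ?_⟩
    · rw [value_mul, value_mul, value_const, value_const, hT₀dep ℓ₁ ℓ₂ h₁ h₂ h₁₂]
    · rw [eq_C_inv_mul_of_nsmul_eq hGpos htot, value_mul, value_const, nsmul_eq_mul, ← mul_assoc,
        map_mul, map_natCast]

/-- **THE EXTRACTION THEOREM (one-sorted).**  A diagonally `Sym_n`-invariant polynomial over `ℂ` that has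
a value derivation (any length) every value of which is fixed by the pointwise stabiliser of `≤ s` indices
(`3s ≤ k`, `s + 3 ≤ n`) is the closed polynomial of a one-sorted labelled pattern expression with `k`
labels. [cite: DawarPagoSeppelt2025, §4 and §7 (p. 45)] -/
theorem exists_diClose_of_supportedDerivation {s : ℕ} (hk : 3 * s ≤ k) (hn : s + 3 ≤ n)
    (𝒟 : ValueDerivation ℂ (Fin n × Fin n))
    (hS : ∀ q ∈ 𝒟.S, ∃ X : Finset (Fin n), X.card ≤ s ∧
      ∀ ρ : Equiv.Perm (Fin n), (∀ x ∈ X, ρ x = x) → ren ρ q = q)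
    {f : MvPolynomial (Fin n × Fin n) ℂ} (hf : f ∈ 𝒟.S) (hfix : ∀ σ : Equiv.Perm (Fin n), ren σ f = f) :
    ∃ e : DiPatternExpr ℂ k, e.close n = f := by
  obtain ⟨E, LX, ℓ₀, hLXc, hinj, hdep, hval⟩ := extraction_repr hk hn 𝒟 hS f hf
  obtain ⟨T, N, hN, hTdep, hTsum⟩ := exists_term hk (∅ : Finset (Fin n)) (∅ : Finset (Fin k)) ℓ₀
    (by simp) (by simp) (by simp) E ℓ₀ LX (hLXc.trans (by omega)) hinj hdep
  have hconst : ∀ ℓ : Fin k → Fin n, value n T ℓ = value n T ℓ₀ := fun ℓ =>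
    hTdep ℓ ℓ₀ (by simp) (by simp) (by simp)
  have huniv : (Finset.univ.filter fun ρ : Equiv.Perm (Fin n) => ∀ x ∈ (∅ : Finset (Fin n)), ρ x = x) =
      Finset.univ := by ext ρ; simp
  rw [huniv, hval, Finset.sum_congr rfl fun ρ _ => hfix ρ, Finset.sum_const, Finset.card_univ] at hTsum
  -- `hTsum : |Sym_n| • f = N • value T ℓ₀`
  have hPpos : 0 < Fintype.card (Equiv.Perm (Fin n)) := Fintype.card_pos
  have hFpos : 0 < Fintype.card (Fin k → Fin n) :=
    Fintype.card_pos_iff.2 ⟨fun _ => ⟨0, by omega⟩⟩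
  have hcloseT : Fintype.card (Fin k → Fin n) • value n T ℓ₀ = T.close n := by
    unfold DiPatternExpr.close
    rw [Finset.sum_congr rfl fun ℓ _ => hconst ℓ, Finset.sum_const, Finset.card_univ]
  have hv : value n T ℓ₀ = C ((Fintype.card (Fin k → Fin n) : ℂ)⁻¹) * T.close n :=
    eq_C_inv_mul_of_nsmul_eq hFpos hcloseT
  have hf' : f = C ((Fintype.card (Equiv.Perm (Fin n)) : ℂ)⁻¹) * (N • value n T ℓ₀) :=
    eq_C_inv_mul_of_nsmul_eq hPpos hTsum
  let cst : ℂ := ((Fintype.card (Equiv.Perm (Fin n)) : ℂ)⁻¹) * (N : ℂ) *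
    ((Fintype.card (Fin k → Fin n) : ℂ)⁻¹)
  refine ⟨mul (const cst) T, ?_⟩
  have hclose_mul : ∀ c : ℂ, (mul (const c) T).close n = C c * T.close n := fun c => by
    unfold DiPatternExpr.close
    simp only [value_mul, value_const]
    rw [Finset.mul_sum]
  rw [hclose_mul, hf', hv, nsmul_eq_mul, map_mul, map_mul, ← map_natCast C (N : ℕ)]
  ring

/-- Arithmetic: `n^{3E} ≤ 2^{(log₂ n + c + 2)^{c+2}}` for `E = (log₂ n + c)^c`. [folklore] -/
theorem pow_three_mul_le (n c : ℕ) :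
    n ^ (3 * (Nat.log 2 n + c) ^ c) ≤ 2 ^ ((Nat.log 2 n + (c + 2)) ^ (c + 2)) := by
  have hlt : n < 2 ^ (Nat.log 2 n + 1) := Nat.lt_pow_succ_log_self Nat.one_lt_two n
  generalize Nat.log 2 n = L at hlt ⊢
  set A := (L + c) ^ c with hA
  calc n ^ (3 * A) ≤ (2 ^ (L + 1)) ^ (3 * A) := Nat.pow_le_pow_left hlt.le _
    _ = 2 ^ ((L + 1) * (3 * A)) := by rw [← pow_mul]
    _ ≤ 2 ^ ((L + (c + 2)) ^ (c + 2)) := Nat.pow_le_pow_right (by norm_num) ?_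
  have h1 : A ≤ (L + (c + 2)) ^ c := Nat.pow_le_pow_left (by omega) c
  have h2 : (L + (c + 2)) ^ (c + 2) = (L + (c + 2)) ^ c * (L + (c + 2)) ^ 2 := pow_add _ _ _
  rw [h2]
  have h3 : (L + 1) * (3 * A) ≤ A * (L + (c + 2)) ^ 2 := by
    have e1 : A * (L + (c + 2)) ^ 2 = A * ((L + (c + 2)) * (L + (c + 2))) := by ring
    rw [e1]
    have : 3 * (L + 1) ≤ (L + (c + 2)) * (L + (c + 2)) := by nlinarith
    calc (L + 1) * (3 * A) = A * (3 * (L + 1)) := by ring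
      _ ≤ A * ((L + (c + 2)) * (L + (c + 2))) := Nat.mul_le_mul_left A this
  exact h3.trans (Nat.mul_le_mul_right _ h1)

/-- **SQUARE-SYMMETRIC CIRCUITS OF QUASI-POLYNOMIAL ORBIT SIZE GIVE NARROW ONE-SORTED EXPRESSIONS** (from
some `n₀` on): the one-sorted extraction at the aside's scale.  With
`NarrowToOrbit.qpOrbit_of_diNarrowExpression` (the converse) this is the one-sorted form of
Dawar–Pago–Seppelt's characterisation at the quasi-polynomial scale; no `VP` hypothesis, no matrix symmetry.
[cite: DawarPagoSeppelt2025, Theorem 1.1 (one-sorted analogue, p. 45); DawarWilsenach2025, §6] -/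
theorem diNarrow_of_qpOrbitFamily (f : (n : ℕ) → MvPolynomial (Fin n × Fin n) ℂ)
    (horb : ∃ c : ℕ, ∀ n : ℕ, ∃ (G : Type) (_ : Fintype G)
        (C : LabelledArithCircuit ℂ (Fin n × Fin n) Unit G),
      C.IsSymmetric (Equiv.Perm (Fin n)) ∧ C.eval (C.output ()) = f n ∧
      C.orbitSize (Equiv.Perm (Fin n)) ≤ 2 ^ ((Nat.log 2 n + c) ^ c)) :
    ∃ c n₀ : ℕ, ∀ n : ℕ, n₀ ≤ n → ∃ (k : ℕ) (e : DiPatternExpr ℂ k),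
      n ^ k ≤ 2 ^ ((Nat.log 2 n + c) ^ c) ∧ e.close n = f n := by
  have hinv : ∀ (n : ℕ) (σ : Equiv.Perm (Fin n)), ren σ (f n) = f n := by
    intro n σ
    obtain ⟨c, hc⟩ := horb
    obtain ⟨G, inst, C, hC, hev, -⟩ := hc n
    rw [← hev]
    exact hC.rename_eval_output_unit σ
  obtain ⟨c, n₀, hsupp⟩ := supportedDerivations_of_qpOrbitFamily f horb
  obtain ⟨n₁, hn₁⟩ := threshold c
  refine ⟨c + 2, max n₀ n₁, fun n hn => ?_⟩
  obtain ⟨𝒟, hf, hS⟩ := hsupp n (le_of_max_le_left hn)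
  obtain ⟨-, h4, -⟩ := hn₁ n (le_of_max_le_right hn)
  set E := (Nat.log 2 n + c) ^ c with hE
  obtain ⟨e, he⟩ := exists_diClose_of_supportedDerivation (k := 3 * E) (s := E) le_rfl (by omega) 𝒟 hS
    hf (hinv n)
  exact ⟨3 * E, e, pow_three_mul_le n c, he⟩

end OrbitSupport

end Summit.ValiantsHypothesis.ValiantsHypothesis.Theorems

end
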